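import Summits.ABC.StewartYu.ArchG3HalfValues
import Summits.ABC.StewartYu.ArchG3Levels
import Summits.ABC.StewartYu.ArchG3Supply
import Literature.NumberTheory.Transcendental.Waldschmidt1980SizeHyp
import Literature.NumberTheory.Transcendental.PiTranscendenceMeasureMain
import HarnessLib

/-!
# Cell abc-stewartyu, rung A1.L (crux r2 `ArchCoreRat`), WP-L.A parcel P-A6 (Kummer half-step): the record-side SUPPLY of the
# separation at the half points — the termwise integrality `D`, real size `Mt` and half-point weight bound `Wh`

`Summits/ABC/StewartYu/ArchG3HalfSupply.lean` — sequel to `ArchG3HalfValues` (seat lp-1 g8: `halfExp`, `oddSet`, `qEhZ`, `rHalf`,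
`halfClassVec`, `exp_Lsum_half`) serving lp-1's `ArchG3HalfSeparation` / `ArchG3LevelStepH` / `ArchG3Schedule` (`ArchLvInv.halfStep`,
pack `ArchHalfStepHypU`, `halfStep_of_hypU`) and the record `ArchG3Par` (seat p1) (cell `abc-stewartyu`, HOME
`run/shared/lean/pub/abc-stewartyu/`; TRANCHE PLAN v1.2 §4′ P-A6; seat p5 g8; cut of HOME/STATUS 2026-08-27T16:25:27Z / 16:32:09Z,
plan RULING R30).  Theorems on `ArchG3Setup`; no definition, no named fact, no parameters.

The half-step separates the `2ⁿ` square-class sums `C_T = halfClassVec R v B p′ (a,0) s T` of `φ_{(a,0)}(s/2)` by the sharp real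
multiquadratic Liouville inequality `Waldschmidt1980.abs_ev_ge_sharp` (print: the product formula over `K = ℚ(√α₁,…,√αₙ)`, Nesterenko
2003 §4.3 (4.42)–(4.45), Lemma 3.11 over `K`).  Its pack carries the data TERMWISE, uniformly over the unknowns `i ∈ U` and the box
`|w′ⱼ| ≤ Lⱼ`: an integrality `Dh(a,s) · ((Hasse_a Rᵢ)(s/2) · qEhZ w′ s) ∈ ℤ`, a real size `|(Hasse_a Rᵢ)(s/2) · qEhZ w′ s| ≤ Mt` and the
half-point weight bound `‖(hw R i a)(s/2)‖ ≤ Wh`.  This file supplies them from the frame's currencies (`|log αⱼ| ≤ Aⱼ`, `h(αⱼ) ≤ Vⱼ`,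
level polynomials `Rᵢ = Δ(·; ℓ₀ i, H) ∘ 2^e·`), with `Dhⱼ := ⌊(Lⱼ|s| + 1)/2⌋ ≥ |⌊w′ⱼ s/2⌋|`:

* integrality: `abs_halfExp_le`, `exists_int_monDen_mul_qEhZ`, **`exists_int_clear_mul_hasse_mul_qEhZ`** (`den₀·monDen(α,Dh)` clears the
  term when `den₀ · (Hasse_a f)(s/2) ∈ ℤ`) and its box form `…_of_box` (the `hint` shape), `exists_int_clear_mul_rHalf_zero` (`w′ = vᵢ`);
  the half-point denominator of the level polynomials `ArchSupply.lcm_pow_mul_hasse_scaledFeldR_half_eq` /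
  `ArchSupply.exists_int_lcm_pow_mul_hasse_scaledFeldR_half` (`ν(H)^a · (Hasse_a(Δ∘2^{e+1}·))(s/2) = 2^a·2^{ea}·zeroWeight ∈ ℤ`: `den₀ = ν(H)^a`);
  costs `log_den₀_mul_monDen_le` (`≤ log den₀ + 2ΣDhⱼ h(αⱼ)`), `ArchSupply.log_lcm_pow_le` (`log ν(H)^a ≤ (23/20)·a·H`);
* sizes: `qEhZ_le_exp` (box: `qEhZ ≤ e^{Σ Dhⱼ Aⱼ}`), `qEhZ_le_exp_slab` (slab: `≤ e^{Λb|s|/2 + ΣAⱼ/2}` when `|Lsum w′| ≤ Λb`),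
  **`abs_hasse_mul_qEhZ_le`** / `…_of_box` (the `hMt` shape: `≤ Xh · e^{Σ Dhⱼ Aⱼ}`) / `…_slab`, `abs_rHalf_zero_le`;
  **`ArchSupply.norm_hw_eval_half_le`** / `ArchSupply.abs_hasse_eval_half_le` (`Wh = Xh = 2^{eN} e^{H/e} (e(1 + 2^e(|s|/2)/H))^{L₀}` at `z = s/2`);
* the threshold in logarithms: `one_le_liouville_base`, `liouville_threshold_eq_exp` (`M/(4DM(∏H)²)^{2ⁿ} = e^{log M − 2ⁿ log(4DM(∏H)²)}`),
  `exp_neg_lt_liouville_threshold` (`2ⁿ·log(4DM(∏H)²) − log M < U ⇒ e^{−U} <` threshold), `log_heightProd_le_sum`,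
  `log_liouville_base_le` (`log(4DM(∏H(αⱼ))²) ≤ log 4 + log D + log M + 2ΣVⱼ`);
* on the invariant: `ArchLvInv.halfExp_abs_le` (the box `|vᵢⱼ| ≤ Lⱼ` gives `|⌊vᵢⱼ s/2⌋| ≤ Dhⱼ`).

WHAT THIS IS NOT: no class-sum fibre lemmas / separation theorem (`ArchG3HalfSeparation`, lp-1), no descent / half-step on `ArchLvInv`
(`ArchG3HalfDescent`, `ArchG3LevelStepH`, lp-1), no record inequality discharged (`ArchG3Par*`, p1); no crux moves.

## References
* Yu. V. Nesterenko, *Linear forms in logarithms of rational numbers*, LNM 1819 (2003) — §4.3 (4.36)–(4.37) p. 90, (4.42)–(4.45)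
  p. 91–92, Lemma 3.11 over `K` p. 93; §3.5 Lemma 3.10 (3.35), Lemma 3.11 (3.42); §3.1 Prop. 3.1. [Nesterenko2003]
* M. Waldschmidt, Acta Arith. 37 (1980) — Lemma 2.2 (p. 261), (3.22) (p. 269–270) (threshold of `abs_ev_ge_sharp`). [Waldschmidt1980]
* P. L. Cijsouw, M. Waldschmidt, Compositio Math. 34 (1977) — §4 (p. 189) (`CW77.mono`, `heightProd`). [CijsouwWaldschmidt1977]
* Yu. Nesterenko, M. Waldschmidt (1996) — §4 (4.2) (`log ν(H) ≤ 1.15H`, tree `NWPi.log_lcmUpto_le`). [NesterenkoWaldschmidt1996]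
-/

noncomputable section

open Finset Polynomial
open Literature.NumberTheory.Transcendental
open Literature.NumberTheory.Transcendental.CW77 (mono heightProd hgt)
open Literature.NumberTheory.Transcendental.CW77.Setup (Tau tauNorm)
open scoped Nat

namespace Summit.ABC.StewartYu

namespace ArchG3Setup

variable (S : ArchG3Setup) {ι : Type*} (R : ι → ℚ[X]) (v : ι → Fin S.n → ℤ)

/-! ### The Liouville threshold in logarithms -/

/-- The Liouville base `4·D·M·(∏H(αⱼ))²` is `≥ 1` (`D, M ≥ 1`). [folklore] -/
theorem one_le_liouville_base {D : ℕ} (hD : 1 ≤ D) {M : ℝ} (hM : 1 ≤ M) : (1 : ℝ) ≤ 4 * D * M * heightProd S.α ^ 2 := by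
  have hD' : (1 : ℝ) ≤ D := by exact_mod_cast hD
  have hP : (1 : ℝ) ≤ heightProd S.α ^ 2 := one_le_pow₀ (CW77.one_le_heightProd S.α)
  have h4 : (1 : ℝ) ≤ 4 * D * M := by nlinarith
  nlinarith

/-- **The Liouville threshold in exponential form**: `M/(4DM(∏H(αⱼ))²)^{2ⁿ} = e^{log M − 2ⁿ·log(4DM(∏H(αⱼ))²)}` (`D, M ≥ 1`).
[cite: Waldschmidt1980, Lemma 2.2 (p. 261); shape only] -/
theorem liouville_threshold_eq_exp {D : ℕ} (hD : 1 ≤ D) {M : ℝ} (hM : 1 ≤ M) :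
    M / (4 * D * M * heightProd S.α ^ 2) ^ (2 ^ S.n) =
      Real.exp (Real.log M - (2 : ℝ) ^ S.n * Real.log (4 * D * M * heightProd S.α ^ 2)) := by
  have hbase : 0 < 4 * (D : ℝ) * M * heightProd S.α ^ 2 := lt_of_lt_of_le one_pos (S.one_le_liouville_base hD hM)
  have hMpos : 0 < M := lt_of_lt_of_le one_pos hM
  rw [Real.exp_sub, Real.exp_log hMpos, show (2 : ℝ) ^ S.n = ((2 ^ S.n : ℕ) : ℝ) by push_cast; rfl, Real.exp_nat_mul,
    Real.exp_log hbase]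

/-- **The record's U-line beats the threshold**: `2ⁿ·log(4DM(∏H(αⱼ))²) − log M < U` ⇒ `e^{−U} < M/(4DM(∏H(αⱼ))²)^{2ⁿ}` — so a bound
`‖φ_τ(s/2)‖ ≤ e^{−U}` feeds the separation's strict hypothesis (print's closing comparison «(n+1)(7.92n+9) > 7.92n²+16n» of the
half-step). [cite: Nesterenko2003, §4.3 (4.45) and Lemma 3.11 over K, p. 92–93] -/
theorem exp_neg_lt_liouville_threshold {D : ℕ} (hD : 1 ≤ D) {M : ℝ} (hM : 1 ≤ M) {U : ℝ}
    (hU : (2 : ℝ) ^ S.n * Real.log (4 * D * M * heightProd S.α ^ 2) - Real.log M < U) :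
    Real.exp (-U) < M / (4 * D * M * heightProd S.α ^ 2) ^ (2 ^ S.n) := by
  rw [S.liouville_threshold_eq_exp hD hM]
  exact Real.exp_lt_exp.mpr (by linarith)

/-! ### Integrality of the half-point terms `(Hasse_a f)(s/2) · qEhZ w′ s` -/

/-- On the box `|wⱼ| ≤ Dboxⱼ`: `|⌊wⱼ s/2⌋| ≤ ⌊(Dboxⱼ·|s| + 1)/2⌋`. [folklore] -/
theorem abs_halfExp_le {Dbox : Fin S.n → ℕ} {w : Fin S.n → ℤ} (hw : ∀ j, |w j| ≤ (Dbox j : ℤ)) (s : ℤ) (j : Fin S.n) :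
    |S.halfExp w s j| ≤ (((Dbox j * s.natAbs + 1) / 2 : ℕ) : ℤ) := by
  unfold halfExp
  have h1 : |w j * s| ≤ (Dbox j : ℤ) * |s| := by
    rw [abs_mul]; exact mul_le_mul_of_nonneg_right (hw j) (abs_nonneg _)
  obtain ⟨hl, hu⟩ := abs_le.mp h1
  have habs : |s| = s ∨ |s| = -s := abs_choice s
  rw [abs_le]
  push_cast
  constructor <;> rcases habs with h | h <;> rw [h] at hl hu ⊢ <;> omega

/-- **The rational part cleared**: for `|⌊wⱼ s/2⌋| ≤ Dhⱼ`, `monDen(α, Dh) · qEhZ w s = z ∈ ℤ` with `|z| ≤ monDen(α, Dh)²`.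
[cite: Nesterenko2003, §3.5 Lemma 3.11 (3.42); shape only] -/
theorem exists_int_monDen_mul_qEhZ {Dh : Fin S.n → ℕ} {w : Fin S.n → ℤ} {s : ℤ} (hw : ∀ j, |S.halfExp w s j| ≤ (Dh j : ℤ)) :
    ∃ z : ℤ, ((MonomialDen.monDen S.α Dh : ℕ) : ℚ) * S.qEhZ w s = z ∧ |z| ≤ ((MonomialDen.monDen S.α Dh : ℤ)) ^ 2 := by
  unfold qEhZ
  exact MonomialDen.exists_int_monDen_mul_prod_zpow S.α S.α_ne Dh (S.halfExp w s) hw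

/-- **The half-point term cleared** — the `hint` datum of the half-step pack, for ANY `Y₀`-weight `f` and exponent vector `w′` with
`|⌊w′ⱼ s/2⌋| ≤ Dhⱼ`: if `den₀ · (Hasse_a f)(s/2) ∈ ℤ` then `den₀ · monDen(α, Dh) · ((Hasse_a f)(s/2) · qEhZ w′ s) ∈ ℤ` — print's
integrality at the finite places of `K` ((4.42)–(4.43): `b_s(ℓ₀, l, y+½, μ̄) ∈ ℤ`). [cite: Nesterenko2003, §4.3 (4.42)–(4.43), p. 91] -/
theorem exists_int_clear_mul_hasse_mul_qEhZ {Dh : Fin S.n → ℕ} {w' : Fin S.n → ℤ} {s : ℤ}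
    (hw : ∀ j, |S.halfExp w' s j| ≤ (Dh j : ℤ)) (f : ℚ[X]) (a : ℕ) {den₀ : ℕ}
    (hf : ∃ z₀ : ℤ, (den₀ : ℚ) * (hasseDeriv a f).eval ((s : ℚ) / 2) = z₀) :
    ∃ z : ℤ, ((den₀ * MonomialDen.monDen S.α Dh : ℕ) : ℚ) * ((hasseDeriv a f).eval ((s : ℚ) / 2) * S.qEhZ w' s) = z := by
  obtain ⟨z₀, hz₀⟩ := hf
  obtain ⟨z₂, hz₂, -⟩ := S.exists_int_monDen_mul_qEhZ hw
  refine ⟨z₀ * z₂, ?_⟩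
  push_cast
  calc (den₀ : ℚ) * (MonomialDen.monDen S.α Dh : ℚ) * ((hasseDeriv a f).eval ((s : ℚ) / 2) * S.qEhZ w' s)
      = ((den₀ : ℚ) * (hasseDeriv a f).eval ((s : ℚ) / 2)) * ((MonomialDen.monDen S.α Dh : ℚ) * S.qEhZ w' s) := by ring
    _ = (z₀ : ℚ) * (z₂ : ℚ) := by rw [hz₀, hz₂]

/-- **The half-point term cleared, box form** (`|w′ⱼ| ≤ Lⱼ`, `Dhⱼ = ⌊(Lⱼ|s|+1)/2⌋`) — the shape of the pack's `hint`.
[cite: Nesterenko2003, §4.3 (4.42)–(4.43), p. 91] -/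
theorem exists_int_clear_mul_hasse_mul_qEhZ_of_box {L : Fin S.n → ℕ} {w' : Fin S.n → ℤ} (hw : ∀ j, |w' j| ≤ (L j : ℤ)) (s : ℤ)
    (f : ℚ[X]) (a : ℕ) {den₀ : ℕ} (hf : ∃ z₀ : ℤ, (den₀ : ℚ) * (hasseDeriv a f).eval ((s : ℚ) / 2) = z₀) :
    ∃ z : ℤ, ((den₀ * MonomialDen.monDen S.α (fun j => (L j * s.natAbs + 1) / 2) : ℕ) : ℚ) *
      ((hasseDeriv a f).eval ((s : ℚ) / 2) * S.qEhZ w' s) = z :=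
  S.exists_int_clear_mul_hasse_mul_qEhZ (fun j => S.abs_halfExp_le hw s j) f a hf

/-- **`rHalf` cleared at the Δ-form orders `(a, 0)`** (no power of `b_{j₀}`): `den₀ · monDen(α, Dh) · rHalf i (a,0) s ∈ ℤ` — the term with
`w′ = vᵢ`, `f = Rᵢ`. [cite: Nesterenko2003, §4.3 (4.42)–(4.43), p. 91] -/
theorem exists_int_clear_mul_rHalf_zero {Dh : Fin S.n → ℕ} (i : ι) {s : ℤ} (hv : ∀ j, |S.halfExp (v i) s j| ≤ (Dh j : ℤ))
    (a : ℕ) {den₀ : ℕ} (hR : ∃ z₀ : ℤ, (den₀ : ℚ) * (hasseDeriv a (R i)).eval ((s : ℚ) / 2) = z₀) :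
    ∃ z : ℤ, ((den₀ * MonomialDen.monDen S.α Dh : ℕ) : ℚ) * S.rHalf R v i ((a, 0) : Tau S.n) s = z := by
  have h := S.exists_int_clear_mul_hasse_mul_qEhZ hv (R i) a hR
  unfold rHalf
  rw [show ((a, 0) : Tau S.n).2 = 0 from rfl, S.zγpow_zero, show ((a, 0) : Tau S.n).1 = a from rfl, mul_one]
  exact h

/-- The clearing denominator is `≥ 1` when `den₀ ≥ 1`. [folklore] -/
theorem one_le_den₀_mul_monDen {Dh : Fin S.n → ℕ} {den₀ : ℕ} (hden₀ : 1 ≤ den₀) : 1 ≤ den₀ * MonomialDen.monDen S.α Dh :=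
  one_le_mul hden₀ (MonomialDen.one_le_monDen S.α S.α_ne _)

/-- **The height cost of the clearing denominator**: `log(den₀ · monDen(α, Dh)) ≤ log den₀ + 2·Σⱼ Dhⱼ·h(αⱼ)` — print's finite part of
Lemma 3.11 over `K` (`2^{−s}nL|z|`-type). [cite: Nesterenko2003, §4.3 (Lemma 3.11 over K), p. 93] -/
theorem log_den₀_mul_monDen_le {Dh : Fin S.n → ℕ} {den₀ : ℕ} (hden₀ : 1 ≤ den₀) :
    Real.log ((den₀ * MonomialDen.monDen S.α Dh : ℕ) : ℝ) ≤
      Real.log den₀ + 2 * ∑ j, (Dh j : ℝ) * Height.logHeight₁ (S.α j) := by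
  have hd0 : (0 : ℝ) < den₀ := by exact_mod_cast (show 0 < den₀ by omega)
  have hm1 : 1 ≤ MonomialDen.monDen S.α Dh := MonomialDen.one_le_monDen S.α S.α_ne _
  have hmpos : (0 : ℝ) < (MonomialDen.monDen S.α Dh : ℝ) := by exact_mod_cast (show 0 < MonomialDen.monDen S.α Dh by omega)
  push_cast
  rw [Real.log_mul hd0.ne' hmpos.ne']
  linarith [MonomialDen.log_monDen_le S.α S.α_ne Dh]

/-! ### Real sizes of the half-point terms -/

/-- **The real size of the rational part**: `qEhZ w s = ∏ⱼ αⱼ^{⌊wⱼ s/2⌋} ≤ e^{Σⱼ Dhⱼ·Aⱼ}` when `|log αⱼ| ≤ Aⱼ` and `|⌊wⱼ s/2⌋| ≤ Dhⱼ`.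
[cite: Nesterenko2003, §3.5 Lemma 3.11 (3.42); shape only] -/
theorem qEhZ_le_exp {A : Fin S.n → ℝ} (hA : ∀ j, |S.lg j| ≤ A j) {Dh : Fin S.n → ℕ} {w : Fin S.n → ℤ} {s : ℤ}
    (hw : ∀ j, |S.halfExp w s j| ≤ (Dh j : ℤ)) :
    (S.qEhZ w s : ℝ) ≤ Real.exp (∑ j, (Dh j : ℝ) * A j) := by
  unfold qEhZ
  push_cast
  refine (S.prod_zpow_le_exp hA _).trans (Real.exp_le_exp.mpr (sum_le_sum fun j _ => ?_))
  have hj : |(S.halfExp w s j : ℝ)| ≤ (Dh j : ℝ) := by exact_mod_cast hw j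
  exact mul_le_mul_of_nonneg_right hj ((abs_nonneg _).trans (hA j))

/-- `|qEhZ w s| = qEhZ w s` (it is positive). [folklore] -/
theorem abs_qEhZ (w : Fin S.n → ℤ) (s : ℤ) : |(S.qEhZ w s : ℝ)| = (S.qEhZ w s : ℝ) :=
  abs_of_pos (by exact_mod_cast S.qEhZ_pos w s)

/-- `∏_{j∈T} √αⱼ ≥ e^{−Σⱼ Aⱼ/2}` when `|log αⱼ| ≤ Aⱼ` (the square-root monomials are not too small). [folklore] -/
theorem exp_neg_half_sum_le_mono {A : Fin S.n → ℝ} (hA : ∀ j, |S.lg j| ≤ A j) (T : Finset (Fin S.n)) :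
    Real.exp (-((∑ j, A j) / 2)) ≤ mono S.α T := by
  have hA0 : ∀ j, 0 ≤ A j := fun j => (abs_nonneg _).trans (hA j)
  have hterm : ∀ j, Real.exp (-(A j / 2)) ≤ Real.sqrt (S.α j : ℝ) := by
    intro j
    rw [Real.sqrt_eq_rpow, Real.rpow_def_of_pos (S.α_pos' j)]
    refine Real.exp_le_exp.mpr ?_
    have h1 : -A j ≤ Real.log (S.α j : ℝ) := by
      have := hA j
      unfold lg at this
      linarith [neg_abs_le (Real.log (S.α j : ℝ))]
    linarith
  calc Real.exp (-((∑ j, A j) / 2)) ≤ Real.exp (∑ j ∈ T, -(A j / 2)) := by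
        refine Real.exp_le_exp.mpr ?_
        have hsub : ∑ j ∈ T, A j ≤ ∑ j, A j := sum_le_sum_of_subset_of_nonneg (subset_univ T) fun j _ _ => hA0 j
        rw [sum_neg_distrib, ← sum_div]
        linarith
    _ = ∏ j ∈ T, Real.exp (-(A j / 2)) := Real.exp_sum _ _
    _ ≤ mono S.α T := prod_le_prod (fun j _ => (Real.exp_pos _).le) fun j _ => hterm j

/-- **The real size of the rational part from the SLAB**: `qEhZ w s · ∏_{j∈oddSet} √αⱼ = e^{Lsum w · s/2}` (`exp_Lsum_half`) and
`∏_{j∈T} √αⱼ ≥ e^{−Σⱼ Aⱼ/2}`, so `qEhZ w s ≤ e^{Λb·|s|/2 + Σⱼ Aⱼ/2}` whenever `|Lsum w| ≤ Λb` (on the invariant's slab `Λb = |γ| + w`,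
`ArchLvInv.abs_Lsum_le`). [cite: Nesterenko2003, §4.3 (4.44), p. 92; shape only] -/
theorem qEhZ_le_exp_slab {A : Fin S.n → ℝ} (hA : ∀ j, |S.lg j| ≤ A j) (w : Fin S.n → ℤ) (s : ℤ) {Λb : ℝ} (hL : |S.Lsum w| ≤ Λb) :
    (S.qEhZ w s : ℝ) ≤ Real.exp (Λb * (|(s : ℝ)| / 2) + (∑ j, A j) / 2) := by
  have hmono_pos : 0 < mono S.α (S.oddSet w s) := prod_pos fun j _ => Real.sqrt_pos.mpr (S.α_pos' j)
  have hmono := S.exp_neg_half_sum_le_mono hA (S.oddSet w s)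
  have hq : (S.qEhZ w s : ℝ) = Real.exp (S.Lsum w * ((s : ℝ) / 2)) / mono S.α (S.oddSet w s) := by
    rw [S.exp_Lsum_half, mul_div_cancel_right₀ _ hmono_pos.ne']
  rw [hq, div_le_iff₀ hmono_pos]
  calc Real.exp (S.Lsum w * ((s : ℝ) / 2)) ≤ Real.exp (Λb * (|(s : ℝ)| / 2)) := by
        refine Real.exp_le_exp.mpr ?_
        calc S.Lsum w * ((s : ℝ) / 2) ≤ |S.Lsum w * ((s : ℝ) / 2)| := le_abs_self _
          _ = |S.Lsum w| * (|(s : ℝ)| / 2) := by rw [abs_mul, abs_div, abs_two]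
          _ ≤ Λb * (|(s : ℝ)| / 2) := mul_le_mul_of_nonneg_right hL (by positivity)
    _ = Real.exp (Λb * (|(s : ℝ)| / 2) + (∑ j, A j) / 2) * Real.exp (-((∑ j, A j) / 2)) := by
        rw [← Real.exp_add]; ring_nf
    _ ≤ Real.exp (Λb * (|(s : ℝ)| / 2) + (∑ j, A j) / 2) * mono S.α (S.oddSet w s) :=
        mul_le_mul_of_nonneg_left hmono (Real.exp_pos _).le

/-- **The real size of the half-point term** — the `hMt` datum of the half-step pack, for any `Y₀`-weight `f`:
`|(Hasse_a f)(s/2) · qEhZ w′ s| ≤ Xh · e^{Σ Dhⱼ Aⱼ}` when `|(Hasse_a f)(s/2)| ≤ Xh`, `|⌊w′ⱼ s/2⌋| ≤ Dhⱼ`, `|log αⱼ| ≤ Aⱼ` (print's (4.44):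
`|Φ_s|_v ≤ max_l |α^{λz}|_v · ΣΣ|p·b_s|`). [cite: Nesterenko2003, §4.3 (4.44), p. 92] -/
theorem abs_hasse_mul_qEhZ_le {A : Fin S.n → ℝ} (hA : ∀ j, |S.lg j| ≤ A j) {Dh : Fin S.n → ℕ} {w' : Fin S.n → ℤ} {s : ℤ}
    (hw : ∀ j, |S.halfExp w' s j| ≤ (Dh j : ℤ)) (f : ℚ[X]) (a : ℕ) {Xh : ℝ}
    (hX : |(((hasseDeriv a f).eval ((s : ℚ) / 2) : ℚ) : ℝ)| ≤ Xh) :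
    |((((hasseDeriv a f).eval ((s : ℚ) / 2) * S.qEhZ w' s : ℚ)) : ℝ)| ≤ Xh * Real.exp (∑ j, (Dh j : ℝ) * A j) := by
  push_cast
  rw [abs_mul, S.abs_qEhZ]
  exact mul_le_mul hX (S.qEhZ_le_exp hA hw) (by exact_mod_cast (S.qEhZ_pos _ _).le) ((abs_nonneg _).trans hX)

/-- **The real size of the half-point term, box form** (`|w′ⱼ| ≤ Lⱼ`) — the shape of the pack's `hMt`:
`|(Hasse_a f)(s/2) · qEhZ w′ s| ≤ Xh · exp(Σⱼ ⌊(Lⱼ|s|+1)/2⌋·Aⱼ)`. [cite: Nesterenko2003, §4.3 (4.44) and Lemma 3.11 over K, p. 92–93] -/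
theorem abs_hasse_mul_qEhZ_le_of_box {A : Fin S.n → ℝ} (hA : ∀ j, |S.lg j| ≤ A j) {L : Fin S.n → ℕ} {w' : Fin S.n → ℤ}
    (hw : ∀ j, |w' j| ≤ (L j : ℤ)) (s : ℤ) (f : ℚ[X]) (a : ℕ) {Xh : ℝ}
    (hX : |(((hasseDeriv a f).eval ((s : ℚ) / 2) : ℚ) : ℝ)| ≤ Xh) :
    |((((hasseDeriv a f).eval ((s : ℚ) / 2) * S.qEhZ w' s : ℚ)) : ℝ)| ≤
      Xh * Real.exp (∑ j, ((((L j * s.natAbs + 1) / 2 : ℕ)) : ℝ) * A j) :=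
  S.abs_hasse_mul_qEhZ_le hA (fun j => S.abs_halfExp_le hw s j) f a hX

/-- **The real size of the half-point term, slab form**: `|(Hasse_a f)(s/2) · qEhZ w′ s| ≤ Xh · e^{Λb|s|/2 + ΣAⱼ/2}` when `|Lsum w′| ≤ Λb`
(on the invariant `Λb = |γ| + w`). [cite: Nesterenko2003, §4.3 (4.44), p. 92; shape only] -/
theorem abs_hasse_mul_qEhZ_le_slab {A : Fin S.n → ℝ} (hA : ∀ j, |S.lg j| ≤ A j) (w' : Fin S.n → ℤ) (s : ℤ) {Λb : ℝ}
    (hL : |S.Lsum w'| ≤ Λb) (f : ℚ[X]) (a : ℕ) {Xh : ℝ} (hX : |(((hasseDeriv a f).eval ((s : ℚ) / 2) : ℚ) : ℝ)| ≤ Xh) :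
    |((((hasseDeriv a f).eval ((s : ℚ) / 2) * S.qEhZ w' s : ℚ)) : ℝ)| ≤
      Xh * Real.exp (Λb * (|(s : ℝ)| / 2) + (∑ j, A j) / 2) := by
  push_cast
  rw [abs_mul, S.abs_qEhZ]
  exact mul_le_mul hX (S.qEhZ_le_exp_slab hA w' s hL) (by exact_mod_cast (S.qEhZ_pos _ _).le) ((abs_nonneg _).trans hX)

/-- **The real size of `rHalf` at a Δ-form order `(a, 0)`**: `|rHalf i (a,0) s| ≤ Xh · e^{Σ Dhⱼ Aⱼ}` (the term with `w′ = vᵢ`, `f = Rᵢ`).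
[cite: Nesterenko2003, §4.3 (4.44), p. 92] -/
theorem abs_rHalf_zero_le {A : Fin S.n → ℝ} (hA : ∀ j, |S.lg j| ≤ A j) {Dh : Fin S.n → ℕ} (i : ι) {s : ℤ}
    (hv : ∀ j, |S.halfExp (v i) s j| ≤ (Dh j : ℤ)) (a : ℕ) {Xh : ℝ}
    (hX : |(((hasseDeriv a (R i)).eval ((s : ℚ) / 2) : ℚ) : ℝ)| ≤ Xh) :
    |(S.rHalf R v i ((a, 0) : Tau S.n) s : ℝ)| ≤ Xh * Real.exp (∑ j, (Dh j : ℝ) * A j) := by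
  have h := S.abs_hasse_mul_qEhZ_le hA hv (R i) a hX
  unfold rHalf
  rw [show ((a, 0) : Tau S.n).2 = 0 from rfl, S.zγpow_zero, show ((a, 0) : Tau S.n).1 = a from rfl, mul_one]
  exact h

/-! ### The logarithm of the Liouville base -/

/-- `log ∏ⱼ H(αⱼ) ≤ Σⱼ Vⱼ` when `h(αⱼ) ≤ Vⱼ`. [folklore] -/
theorem log_heightProd_le_sum {V : Fin S.n → ℝ} (hV : ∀ j, Height.logHeight₁ (S.α j) ≤ V j) :
    Real.log (heightProd S.α) ≤ ∑ j, V j := by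
  unfold CW77.heightProd
  rw [Real.log_prod (s := univ) (fun j _ => (lt_of_lt_of_le one_pos (CW77.one_le_hgt (S.α j))).ne')]
  exact sum_le_sum fun j _ => by rw [CW77.log_hgt_eq_logHeight₁]; exact hV j

/-- **The logarithm of the Liouville base**: `log(4·D·M·(∏ⱼH(αⱼ))²) ≤ log 4 + log D + log M + 2·Σⱼ Vⱼ` when `h(αⱼ) ≤ Vⱼ` (`D, M ≥ 1`) —
the record multiplies this by the degree `2ⁿ` (print: the height line of Lemma 3.11 over `K` is `[K:ℚ]` times the height over `ℚ`).
[cite: Nesterenko2003, §4.3 (Lemma 3.11 over K), p. 93] -/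
theorem log_liouville_base_le {D : ℕ} (hD : 1 ≤ D) {M : ℝ} (hM : 1 ≤ M) {V : Fin S.n → ℝ}
    (hV : ∀ j, Height.logHeight₁ (S.α j) ≤ V j) :
    Real.log (4 * D * M * heightProd S.α ^ 2) ≤ Real.log 4 + Real.log D + Real.log M + 2 * ∑ j, V j := by
  have hD' : (0 : ℝ) < D := by exact_mod_cast (show 0 < D by omega)
  have hMpos : 0 < M := lt_of_lt_of_le one_pos hM
  have hP : 0 < heightProd S.α := lt_of_lt_of_le one_pos (CW77.one_le_heightProd S.α)
  rw [Real.log_mul (by positivity) (by positivity), Real.log_mul (by positivity) hMpos.ne',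
    Real.log_mul (by norm_num) hD'.ne', Real.log_pow]
  push_cast
  linarith [S.log_heightProd_le_sum hV]

/-! ### The box of the level invariant `ArchLvInv` -/

namespace ArchLvInv

variable {S} {R : ι → ℚ[X]} {B : Finset ι} {v : ι → Fin S.n → ℤ} {pv : ι → ℤ} {lo : Fin S.n → ℤ} {L : Fin S.n → ℕ} {P : ℤ}
  {w γ : ℝ} {c : ℤ} {e : Fin S.n → ℤ} {Xs : Set ℤ} {T : ℕ}

/-- On the invariant's box `|vᵢⱼ| ≤ Lⱼ`: `|⌊vᵢⱼ s/2⌋| ≤ ⌊(Lⱼ|s| + 1)/2⌋` — the termwise data at `w′ = vᵢ` are instances of the box forms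
above. [folklore] -/
theorem halfExp_abs_le (h : S.ArchLvInv R B v pv lo L P w γ c e Xs T) (s : ℤ) :
    ∀ i ∈ B, ∀ j, |S.halfExp (v i) s j| ≤ (((L j * s.natAbs + 1) / 2 : ℕ) : ℤ) :=
  fun i hi j => S.abs_halfExp_le (h.abs_le i hi) s j

end ArchLvInv

end ArchG3Setup

/-! ### The `Y₀`-weights of the level polynomials `Δ(·; ℓ, H) ∘ 2^e·` at the half point -/

namespace ArchSupply

open Summit.ABC.StewartYu.FeldmanBasis (feldR lcm_pow_mul_hasse_feldR_eq_zeroWeight)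

/-- **Integrality at a half point, one level up, EXACT**: `ν(H)^a · (Hasse_a (Δ(·;ℓ,H) ∘ 2^{e+1}·))(s/2) = 2^a · 2^{ea} · w₀` with the
integer zero-direction weight `w₀ = zeroWeight ℓ H a (2^e s)` of the node `s` one level down (`|w₀| ≤ ν(H)^a e^{H/e}(e(1+2^e|s|/H))^ℓ`,
`DirWeights.abs_zeroWeight_le`): the half-step's `den₀` is the integer-node `ν(H)^a`, unchanged.
[cite: Nesterenko2003, §4.3 (4.36)–(4.37) and (4.42), p. 90–91] [cite: Nesterenko2003, §3.1 Prop. 3.1 (1)] -/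
theorem lcm_pow_mul_hasse_scaledFeldR_half_eq (ℓ : ℕ) {H : ℕ} (hH : 1 ≤ H) (e a : ℕ) (s : ℤ) :
    (((Nat.lcmUpto H) ^ a : ℕ) : ℚ) * (hasseDeriv a (scaledFeldR ℓ H (e + 1))).eval ((s : ℚ) / 2) =
      (((2 : ℤ) ^ a * (2 : ℤ) ^ (e * a) * DirWeights.zeroWeight ℓ H a (2 ^ e * s) : ℤ) : ℚ) := by
  rw [hasse_scaledFeldR_half, hasse_scaledFeldR_eval]
  have h := lcm_pow_mul_hasse_feldR_eq_zeroWeight ℓ hH a (2 ^ e * s)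
  push_cast at h ⊢
  rw [← pow_mul]
  calc ((Nat.lcmUpto H : ℚ)) ^ a * ((2 : ℚ) ^ a * ((2 : ℚ) ^ (e * a) * (hasseDeriv a (feldR ℓ H)).eval ((2 : ℚ) ^ e * (s : ℚ))))
      = (2 : ℚ) ^ a * (2 : ℚ) ^ (e * a) * (((Nat.lcmUpto H : ℚ)) ^ a * (hasseDeriv a (feldR ℓ H)).eval ((2 : ℚ) ^ e * (s : ℚ))) := by
        ring
    _ = (2 : ℚ) ^ a * (2 : ℚ) ^ (e * a) * (DirWeights.zeroWeight ℓ H a (2 ^ e * s) : ℚ) := by rw [h]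

/-- `ν(H)^a · (Hasse_a (Δ ∘ 2^{e+1}·))(s/2) ∈ ℤ` (the `den₀`-integrality the termwise `hint` consumes, `den₀ = ν(H)^a`).
[cite: Nesterenko2003, §4.3 (4.42), p. 91] -/
theorem exists_int_lcm_pow_mul_hasse_scaledFeldR_half (ℓ : ℕ) {H : ℕ} (hH : 1 ≤ H) (e a : ℕ) (s : ℤ) :
    ∃ z₀ : ℤ, (((Nat.lcmUpto H) ^ a : ℕ) : ℚ) * (hasseDeriv a (scaledFeldR ℓ H (e + 1))).eval ((s : ℚ) / 2) = z₀ :=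
  ⟨_, lcm_pow_mul_hasse_scaledFeldR_half_eq ℓ hH e a s⟩

/-- The cost of the half-point denominator: `log ν(H)^a ≤ (23/20)·a·H` (`log ν(H) = ψ(H) ≤ 1.15 H`, tree `NWPi.log_lcmUpto_le`).
[cite: NesterenkoWaldschmidt1996, §4 (4.2)] -/
theorem log_lcm_pow_le (H a : ℕ) : Real.log ((((Nat.lcmUpto H) ^ a : ℕ)) : ℝ) ≤ 23 / 20 * a * H := by
  push_cast
  rw [Real.log_pow]
  have h := NWPi.log_lcmUpto_le H
  have ha : (0 : ℝ) ≤ a := Nat.cast_nonneg _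
  nlinarith

/-- **The `Y₀`-weight at the half point on the complex side** — the `Wh` of the extrapolation bound at `z = s/2`: for
`Rᵢ = Δ(·; ℓ₀ i, H) ∘ 2^e·`, `ℓ₀ i ≤ L₀`, `a ≤ N`: `‖(hw R i a)(s/2)‖ ≤ 2^{eN} · e^{H/e} · (e(1 + 2^e(|s|/2)/H))^{L₀}` (`norm_hw_scaledFeldR_le_of_le` on
the disc `‖z‖ ≤ |s|/2`). [cite: Nesterenko2003, §3.5 Lemma 3.10 (3.35); §4.3 (4.44), p. 92] -/
theorem norm_hw_eval_half_le {ι : Type*} (ℓ₀ : ι → ℕ) {H : ℕ} (hH : 1 ≤ H) (e : ℕ) {L₀ N : ℕ} (i : ι) (hi : ℓ₀ i ≤ L₀)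
    {a : ℕ} (ha : a ≤ N) (s : ℤ) :
    ‖(ArchG3Setup.hw (fun i => scaledFeldR (ℓ₀ i) H e) i a).eval ((s : ℂ) / 2)‖ ≤
      (2 : ℝ) ^ (e * N) * (Real.exp (H / Real.exp 1) * (Real.exp 1 * (1 + (2 : ℝ) ^ e * (|(s : ℝ)| / 2) / H)) ^ L₀) := by
  have hz : ‖((s : ℂ) / 2)‖ ≤ |(s : ℝ)| / 2 := by
    rw [norm_div, Complex.norm_intCast]
    norm_num
  exact norm_hw_scaledFeldR_le_of_le ℓ₀ hH e i hi ha hz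

/-- The same bound for the rational value `(Hasse_a Rᵢ)(s/2)` read in `ℝ` — the `Xh` of the termwise size `Mt`.
[cite: Nesterenko2003, §4.3 (4.44), p. 92] -/
theorem abs_hasse_eval_half_le {ι : Type*} (ℓ₀ : ι → ℕ) {H : ℕ} (hH : 1 ≤ H) (e : ℕ) {L₀ N : ℕ} (i : ι) (hi : ℓ₀ i ≤ L₀)
    {a : ℕ} (ha : a ≤ N) (s : ℤ) :
    |(((hasseDeriv a (scaledFeldR (ℓ₀ i) H e)).eval ((s : ℚ) / 2) : ℚ) : ℝ)| ≤
      (2 : ℝ) ^ (e * N) * (Real.exp (H / Real.exp 1) * (Real.exp 1 * (1 + (2 : ℝ) ^ e * (|(s : ℝ)| / 2) / H)) ^ L₀) := by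
  have h := norm_hw_eval_half_le ℓ₀ hH e i hi ha s
  rw [show ((s : ℂ) / 2) = ((((s : ℚ) / 2 : ℚ)) : ℂ) by push_cast; ring, ArchG3Setup.hw_eval_ratCast,
    ← Complex.ofReal_ratCast, Complex.norm_real, Real.norm_eq_abs] at h
  exact h

end ArchSupply

end Summit.ABC.StewartYu

end
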